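import Summits.QuantumFields.YangMills.Theses.LangevinControlUV
import Literature.MathematicalPhysics.QuantumLattice.TorusWilsonMarkov
import Literature.MathematicalPhysics.QuantumLattice.WilsonBlockHeatBathSemigroup
import Literature.MathematicalPhysics.QuantumLattice.WilsonBlockHeatBathLightCone2

/-!
# Crux `LatticeGapInUVUnitsC`, line `nested-shell-rho-mixing`: the def-free reduction to the one-sided shell certificate

Support file for item stmt-QuantumFields-16206 (route `LangevinControlUV` of `YangMills`), line lead
prover-line-stmt-QuantumFields-16206-c1-0 (skeleton `Cruxes/LatticeGapInUVUnitsC/Lines/nested_shell_rho_mixing.lean`, registered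
stubs `stub_boxMixing` S1, `stub_boxToDecay` S2, `stub_boxDecayToClustering` S3).  The line is the ONE-SIDED (closed box)
variant of the landed femto-slab pipeline (`…LatticeGapInUVUnitsSlabToDecay` p96985, `…DecayToClustering` p97393,
`…SlabReduction` p99152): boxes `{ℓ | ∀ ν, (ℓ.1 ν − x ν).val < w}` of the torus `(ℤ/(2S+1))⁴` (the tree's cylinder convention,
`condExp_wilsonMeasure_markov_slab`) replace time slabs, so that interior and exterior are separated by ONE closed shell (idea card
`Ideas/nested-shell-rho-mixing.md`: Hirschfeld–Gebelein–Rényi maximal correlation is submultiplicative along the Markov chain of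
nested separating shells).  This file records, kernel-checked and with every statement WRITTEN OUT (no definition introduced):

* `reduction_concl_of_box` : S2 + S3 (as hypotheses) + a box inequality family at margin `⌈Θ/a β⌉` ⇒ clustering at rate
  `(κ/(2Θ)) a(β) n` — the constant-slack bookkeeping, `Tendsto a atTop (𝓝 0)` load-bearing exactly at `⌈Θ/a β⌉ a β ≤ 2Θ`
  (Disproof §2 of the crux);
* `cruxC_of_boxStubs` : S1 → S2 → S3 → `LatticeGapInUVUnitsC` BY NAME (the three registered stub signatures verbatim as
  hypotheses; S1 is fed the package, as the standing Disproof requires).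

CLOSING RECIPE: when S1, S2, S3 land as theorems `T1 T2 T3` with the registered signatures, the crux closes with
`theorem LatticeGapInUVUnitsC_holds : LatticeGapInUVUnitsC := cruxC_of_boxStubs T1 T2 T3` (`--workitem stmt-QuantumFields-16206`).
S2 and S3 are provable ports of p96985/p97393; S1 is the open physics (the mass gap at the physical scale `Θ` in one-sided
maximal-correlation clothing).
-/

open scoped BigOperators
open MeasureTheory Filter Topology
open Literature.MathematicalPhysics.QuantumFieldTheory Literature.MathematicalPhysics.QuantumLattice
open Summit.QuantumFields.YangMills.Theses.LangevinControlUV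

noncomputable section

namespace Summit.QuantumFields.YangMills.Theorems.LatticeGapInUVUnitsC.NestedShell

section Pipeline

variable {G : Type} [Group G] [TopologicalSpace G] [IsTopologicalGroup G] [CompactSpace G]
  [MeasurableSpace G] [BorelSpace G]

/-- **S2 + S3 + `a → 0` ⇒ clustering in the units of `a`** (constant-slack bookkeeping, the slab pipeline with boxes):
with `q = 1 − 1/K ∈ [0,1)`, S3 gives `κ(q) > 0` and per-pair constants, S2 turns the box inequality at margin `⌈Θ/a β⌉ ≥ 1`
into decay, and `⌈Θ/a β⌉ a β ≤ Θ + a β ≤ 2Θ` once `a β ≤ Θ` gives the rate `(κ/(2Θ)) a β n`. -/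
theorem reduction_concl_of_box (h2 : ∀ (G : Type) [Group G] [TopologicalSpace G] [IsTopologicalGroup G] [CompactSpace G] [MeasurableSpace G] [BorelSpace G] (r : LatticeRep G) (β : ℝ) (S D : ℕ) (K : ℝ) (μ : Measure (GaugeConfig 4 (2 * S + 1) G)), μ = (wilsonMeasure r.ρ β : Measure (GaugeConfig 4 (2 * S + 1) G)) → 1 ≤ D → 1 ≤ K → (∀ (x : Fin 4 → ZMod (2 * S + 1)) (w : ℕ), w + 2 * D ≤ 2 * S → ∀ F : GaugeConfig 4 (2 * S + 1) G → ℝ, Measurable F → (∃ M : ℝ, ∀ U, |F U| ≤ M) → DependsOn F {ℓ : Edge 4 (2 * S + 1) | ∀ ν, (ℓ.1 ν - x ν).val < w} → ∫ U, (F U - ∫ V, F V ∂μ) ^ 2 ∂μ ≤ K * ∫ U, (F U - (μ[F|cylinderEvents {ℓ : Edge 4 (2 * S + 1) | ∀ ν, (ℓ.1 ν - (x ν - ((D - 1 : ℕ) : ZMod (2 * S + 1)))).val < w + 2 * (D - 1)}ᶜ]) U) ^ 2 ∂μ) → ∀ (x : Fin 4 → ZMod (2 * S + 1)) (w j : ℕ),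 w + 2 * (j * D) ≤ 2 * S → ∀ F : GaugeConfig 4 (2 * S + 1) G → ℝ, Measurable F → (∃ M : ℝ, ∀ U, |F U| ≤ M) → DependsOn F {ℓ : Edge 4 (2 * S + 1) | ∀ ν, (ℓ.1 ν - x ν).val < w} → ∫ U, ((μ[F|cylinderEvents {ℓ : Edge 4 (2 * S + 1) | ∀ ν, (ℓ.1 ν - (x ν - ((j * D - 1 : ℕ) : ZMod (2 * S + 1)))).val < w + 2 * (j * D - 1)}ᶜ]) U - ∫ V, F V ∂μ) ^ 2 ∂μ ≤ (1 - 1 / K) ^ j * ∫ U, (F U - ∫ V, F V ∂μ) ^ 2 ∂μ) (h3 : ∀ (G : Type) [Group G] [TopologicalSpace G] [IsTopologicalGroup G] [CompactSpace G] [MeasurableSpace G] [BorelSpace G] (r : LatticeRep G) (q : ℝ), 0 ≤ q → q < 1 → ∃ κ : ℝ, 0 < κ ∧ ∀ A B : YMSpecies G, ∃ C : ℝ, ∀ (β : ℝ) (S D n : ℕ) (μ : Measure (GaugeConfig 4 (2 * S + 1) G)), μ = (wilsonMeasure r.ρ β : Measure (GaugeConfig 4 (2 * S + 1) G)) → 1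 ≤ D → n ≤ S → (∀ (x : Fin 4 → ZMod (2 * S + 1)) (w j : ℕ), w + 2 * (j * D) ≤ 2 * S → ∀ F : GaugeConfig 4 (2 * S + 1) G → ℝ, Measurable F → (∃ M : ℝ, ∀ U, |F U| ≤ M) → DependsOn F {ℓ : Edge 4 (2 * S + 1) | ∀ ν, (ℓ.1 ν - x ν).val < w} → ∫ U, ((μ[F|cylinderEvents {ℓ : Edge 4 (2 * S + 1) | ∀ ν, (ℓ.1 ν - (x ν - ((j * D - 1 : ℕ) : ZMod (2 * S + 1)))).val < w + 2 * (j * D - 1)}ᶜ]) U - ∫ V, F V ∂μ) ^ 2 ∂μ ≤ q ^ j * ∫ U, (F U - ∫ V, F V ∂μ) ^ 2 ∂μ) → |latticeConnectedCorr r.ρ β (2 * S + 1) A.F B.F n| ≤ C * Real.exp (-(κ / D * n))) (r : LatticeRep G) {a : ℝ → ℝ} (hpos : ∀ β, 0 < a β)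
    (hlim : Tendsto a atTop (𝓝 0)) {Θ K β₂ : ℝ} {S₁ : ℝ → ℕ} (hΘ : 0 < Θ) (hK : 1 ≤ K)
    (hbox : ∀ β : ℝ, β₂ ≤ β → ∀ S : ℕ, S₁ β ≤ S → ∀ (μ : Measure (GaugeConfig 4 (2 * S + 1) G)), μ = (wilsonMeasure r.ρ β : Measure (GaugeConfig 4 (2 * S + 1) G)) → ∀ (x : Fin 4 → ZMod (2 * S + 1)) (w : ℕ), w + 2 * ⌈Θ / a β⌉₊ ≤ 2 * S → ∀ F : GaugeConfig 4 (2 * S + 1) G → ℝ, Measurable F → (∃ M : ℝ, ∀ U, |F U| ≤ M) → DependsOn F {ℓ : Edge 4 (2 * S + 1) | ∀ ν, (ℓ.1 ν - x ν).val < w} → ∫ U, (F U - ∫ V, F V ∂μ) ^ 2 ∂μ ≤ K * ∫ U, (F U - (μ[F|cylinderEvents {ℓ : Edge 4 (2 * S + 1) | ∀ ν, (ℓ.1 ν - (x ν - ((⌈Θ / a β⌉₊ - 1 : ℕ) : ZMod (2 * S + 1)))).val < w + 2 * (⌈Θ / a β⌉₊ - 1)}ᶜ]) U) ^ 2 ∂μ)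 :
    ∃ (c₁ β₂ : ℝ) (S₁ : ℝ → ℕ), 0 < c₁ ∧ ∀ A B : YMSpecies G, ∃ C : ℝ, ∀ β : ℝ, β₂ ≤ β → ∀ S n : ℕ, S₁ β ≤ S → n ≤ S → |latticeConnectedCorr r.ρ β (2 * S + 1) A.F B.F n| ≤ C * Real.exp (-(c₁ * a β * n)) := by
  have hK0 : 0 < K := lt_of_lt_of_le one_pos hK
  have hq0 : 0 ≤ 1 - 1 / K := by
    have : 1 / K ≤ 1 := by rw [div_le_one hK0]; exact hK
    linarith
  have hq1 : 1 - 1 / K < 1 := by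
    have : 0 < 1 / K := by positivity
    linarith
  obtain ⟨κ, hκ, hAB⟩ := h3 G r (1 - 1 / K) hq0 hq1
  obtain ⟨β₃, hβ₃⟩ := eventually_atTop.1 (hlim (Iio_mem_nhds hΘ))
  refine ⟨κ / (2 * Θ), max β₂ β₃, S₁, by positivity, fun A B => ?_⟩
  obtain ⟨C, hC⟩ := hAB A B
  refine ⟨max C 0, fun β hβ S n hS hn => ?_⟩
  have hβ2 : β₂ ≤ β := (le_max_left _ _).trans hβ
  have haΘ : a β < Θ := hβ₃ β ((le_max_right _ _).trans hβ)
  have hΘa : 0 < Θ / a β := div_pos hΘ (hpos β)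
  have hD1 : 1 ≤ ⌈Θ / a β⌉₊ := Nat.one_le_iff_ne_zero.2 (Nat.ceil_pos.2 hΘa).ne'
  have hdec := h2 G r β S ⌈Θ / a β⌉₊ K _ rfl hD1 hK (hbox β hβ2 S hS _ rfl)
  refine (hC β S ⌈Θ / a β⌉₊ n _ rfl hD1 hn hdec).trans ?_
  have hDR : ((⌈Θ / a β⌉₊ : ℕ) : ℝ) < Θ / a β + 1 := Nat.ceil_lt_add_one hΘa.le
  have hDa : ((⌈Θ / a β⌉₊ : ℕ) : ℝ) * a β ≤ 2 * Θ := by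
    have h1 : ((⌈Θ / a β⌉₊ : ℕ) : ℝ) * a β < (Θ / a β + 1) * a β := mul_lt_mul_of_pos_right hDR (hpos β)
    have h2' : (Θ / a β + 1) * a β = Θ + a β := by
      rw [add_mul, one_mul, div_mul_cancel₀ Θ (hpos β).ne']
    linarith
  have hDpos : (0 : ℝ) < ((⌈Θ / a β⌉₊ : ℕ) : ℝ) := by exact_mod_cast hD1
  have hn0 : (0 : ℝ) ≤ n := Nat.cast_nonneg n
  have key : κ / (2 * Θ) * a β * n ≤ κ / (⌈Θ / a β⌉₊ : ℕ) * n := by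
    refine mul_le_mul_of_nonneg_right ?_ hn0
    rw [div_mul_eq_mul_div, div_le_div_iff₀ (by positivity) hDpos]
    calc κ * a β * ((⌈Θ / a β⌉₊ : ℕ) : ℝ) = κ * (((⌈Θ / a β⌉₊ : ℕ) : ℝ) * a β) := by ring
      _ ≤ κ * (2 * Θ) := mul_le_mul_of_nonneg_left hDa hκ.le
  calc C * Real.exp (-(κ / (⌈Θ / a β⌉₊ : ℕ) * n)) ≤ max C 0 * Real.exp (-(κ / (⌈Θ / a β⌉₊ : ℕ) * n)) :=
        mul_le_mul_of_nonneg_right (le_max_left _ _) (Real.exp_pos _).le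
    _ ≤ max C 0 * Real.exp (-(κ / (2 * Θ) * a β * n)) :=
        mul_le_mul_of_nonneg_left (Real.exp_le_exp.2 (neg_le_neg key)) (le_max_right _ _)


end Pipeline

/-- **The line's reduction, def-free**: S1 (`stub_boxMixing`, the one-sided shell certificate) + S2 (`stub_boxToDecay`) +
S3 (`stub_boxDecayToClustering`), each registered signature verbatim as a hypothesis, ⇒ the crux `LatticeGapInUVUnitsC` BY NAME. -/
theorem cruxC_of_boxStubs : (∀ (G : Type) [Group G] [TopologicalSpace G] [IsTopologicalGroup G] [CompactSpace G], IsCompactSimpleLieGroup G → letI : MeasurableSpace G := borel G; haveI : BorelSpace G := ⟨rfl⟩; ∀ (r : LatticeRep G) (a : ℝ → ℝ), Continuous a → (∃ (Γ : ℝ → ℝ) (β₀ ℓ₀ c C : ℝ), 0 < ℓ₀ ∧ 0 < c ∧ (∀ β, 0 < a β) ∧ Filter.Tendsto a Filter.atTop (nhds 0) ∧ (∀ s : ℝ, 0 < s → s ≤ ℓ₀ → 0 < Γ s ∧ Γ s ≤ 1) ∧ ∀ (L : ℕ) [NeZero L] (β : ℝ), β₀ ≤ β → (L : ℝ) * a β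 ≤ ℓ₀ → let P : (Fin 4 → ZMod L) → Fin 4 → Fin 4 → GaugeConfig 4 L G → ℝ := fun x i j U => (r.N : ℝ) - (r.ρ (plaquetteHolonomy U x i j)).trace.re; let E : (GaugeConfig 4 L G → ℝ) → ℝ := fun F => wilsonExpectation (d := 4) (L := L) r.ρ β F; let cov : (GaugeConfig 4 L G → ℝ) → (GaugeConfig 4 L G → ℝ) → ℝ := fun F F' => E (fun U => F U * F' U) - E F * E F'; let dist : (Fin 4 → ZMod L) → (Fin 4 → ZMod L) → ℝ := fun x y => Real.sqrt (∑ k : Fin 4, (((x k - y k).valMinAbs : ℤ) : ℝ) ^ 2); (∀ n : ℕ, 1 ≤ n → 8 * n ≤ L → c * Γ ((n : ℝ) * a β) ≤ (n : ℝ) ^ 8 * cov (P 0 0 1) (P (Pi.single (2 : Fin 4) ((n : ℕ) : ZMod L)) 0 1) ∧ (n : ℝ) ^ 8 * cov (P 0 0 1) (P (Pi.single (2 : Fin 4) ((n : ℕ) : ZMod L)) 0 1) ≤ C * Γ ((n : ℝ) * a β)) ∧ (∀ (x y : Fin 4 → ZMod L) (i j i' j' : Fin 4), x ≠ y → i ≠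 j → i' ≠ j' → |cov (P x i j) (P y i' j')| * dist x y ^ 8 ≤ C * Γ (dist x y * a β))) → ∃ (Θ K β₂ : ℝ) (S₁ : ℝ → ℕ), 0 < Θ ∧ 1 ≤ K ∧ ∀ β : ℝ, β₂ ≤ β → ∀ S : ℕ, S₁ β ≤ S → ∀ (μ : Measure (GaugeConfig 4 (2 * S + 1) G)), μ = (wilsonMeasure r.ρ β : Measure (GaugeConfig 4 (2 * S + 1) G)) → ∀ (x : Fin 4 → ZMod (2 * S + 1)) (w : ℕ), w + 2 * ⌈Θ / a β⌉₊ ≤ 2 * S → ∀ F : GaugeConfig 4 (2 * S + 1) G → ℝ, Measurable F → (∃ M : ℝ, ∀ U, |F U| ≤ M) → DependsOn F {ℓ : Edge 4 (2 * S + 1) | ∀ ν, (ℓ.1 ν - x ν).val < w} → ∫ U, (F U - ∫ V, F V ∂μ) ^ 2 ∂μ ≤ K * ∫ U, (F U - (μ[F|cylinderEvents {ℓ : Edge 4 (2 * S + 1) | ∀ ν, (ℓ.1 ν - (x ν - ((⌈Θ / a β⌉₊ - 1 : ℕ) : ZMod (2 * S + 1)))).val < w + 2 * (⌈Θ / a β⌉₊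 - 1)}ᶜ]) U) ^ 2 ∂μ) → (∀ (G : Type) [Group G] [TopologicalSpace G] [IsTopologicalGroup G] [CompactSpace G] [MeasurableSpace G] [BorelSpace G] (r : LatticeRep G) (β : ℝ) (S D : ℕ) (K : ℝ) (μ : Measure (GaugeConfig 4 (2 * S + 1) G)), μ = (wilsonMeasure r.ρ β : Measure (GaugeConfig 4 (2 * S + 1) G)) → 1 ≤ D → 1 ≤ K → (∀ (x : Fin 4 → ZMod (2 * S + 1)) (w : ℕ), w + 2 * D ≤ 2 * S → ∀ F : GaugeConfig 4 (2 * S + 1) G → ℝ, Measurable F → (∃ M : ℝ, ∀ U, |F U| ≤ M) → DependsOn F {ℓ : Edge 4 (2 * S + 1) | ∀ ν, (ℓ.1 ν - x ν).val < w} → ∫ U, (F U - ∫ V, F V ∂μ) ^ 2 ∂μ ≤ K * ∫ U, (F U - (μ[F|cylinderEvents {ℓ : Edge 4 (2 * S + 1) | ∀ ν, (ℓ.1 ν - (x ν - ((D - 1 : ℕ) : ZMod (2 * S + 1)))).val < w + 2 * (D - 1)}ᶜ]) U) ^ 2 ∂μ) → ∀ (x : Fin 4 → ZMod (2 * S + 1))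 (w j : ℕ), w + 2 * (j * D) ≤ 2 * S → ∀ F : GaugeConfig 4 (2 * S + 1) G → ℝ, Measurable F → (∃ M : ℝ, ∀ U, |F U| ≤ M) → DependsOn F {ℓ : Edge 4 (2 * S + 1) | ∀ ν, (ℓ.1 ν - x ν).val < w} → ∫ U, ((μ[F|cylinderEvents {ℓ : Edge 4 (2 * S + 1) | ∀ ν, (ℓ.1 ν - (x ν - ((j * D - 1 : ℕ) : ZMod (2 * S + 1)))).val < w + 2 * (j * D - 1)}ᶜ]) U - ∫ V, F V ∂μ) ^ 2 ∂μ ≤ (1 - 1 / K) ^ j * ∫ U, (F U - ∫ V, F V ∂μ) ^ 2 ∂μ) → (∀ (G : Type) [Group G] [TopologicalSpace G] [IsTopologicalGroup G] [CompactSpace G] [MeasurableSpace G] [BorelSpace G] (r : LatticeRep G) (q : ℝ), 0 ≤ q → q < 1 → ∃ κ : ℝ, 0 < κ ∧ ∀ A B : YMSpecies G, ∃ C : ℝ, ∀ (β : ℝ) (S D n : ℕ) (μ : Measure (GaugeConfig 4 (2 * S + 1) G)), μ = (wilsonMeasure r.ρ β : Measure (GaugeConfig 4 (2 * S + 1) G))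 → 1 ≤ D → n ≤ S → (∀ (x : Fin 4 → ZMod (2 * S + 1)) (w j : ℕ), w + 2 * (j * D) ≤ 2 * S → ∀ F : GaugeConfig 4 (2 * S + 1) G → ℝ, Measurable F → (∃ M : ℝ, ∀ U, |F U| ≤ M) → DependsOn F {ℓ : Edge 4 (2 * S + 1) | ∀ ν, (ℓ.1 ν - x ν).val < w} → ∫ U, ((μ[F|cylinderEvents {ℓ : Edge 4 (2 * S + 1) | ∀ ν, (ℓ.1 ν - (x ν - ((j * D - 1 : ℕ) : ZMod (2 * S + 1)))).val < w + 2 * (j * D - 1)}ᶜ]) U - ∫ V, F V ∂μ) ^ 2 ∂μ ≤ q ^ j * ∫ U, (F U - ∫ V, F V ∂μ) ^ 2 ∂μ) → |latticeConnectedCorr r.ρ β (2 * S + 1) A.F B.F n| ≤ C * Real.exp (-(κ / D * n))) → LatticeGapInUVUnitsC := by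
  intro h1 h2 h3 G _ _ _ _ hG
  letI : MeasurableSpace G := borel G
  haveI : BorelSpace G := ⟨rfl⟩
  intro r a ha hP
  obtain ⟨Θ, K, β₂, S₁, hΘ, hK, hbox⟩ := h1 G hG r a ha hP
  obtain ⟨Γ, β₀, ℓ₀, c, C, -, -, hpos, hlim, -, -⟩ := hP
  exact reduction_concl_of_box h2 h3 r hpos hlim hΘ hK hbox

end Summit.QuantumFields.YangMills.Theorems.LatticeGapInUVUnitsC.NestedShell

end
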